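import Mathlib.Algebra.Polynomial.Div
import Mathlib.Algebra.CharP.Lemmas
import Mathlib.RingTheory.Polynomial.Basic
import Mathlib.Data.ZMod.Basic
import Mathlib.Tactic
import HarnessLib

/-!
# BirchSwinnertonDyer — rank ≥ 2 observatory: the first-layer truncation lemma of instrument MS9

HONEST FRAMING: per-curve certified theorems and census instruments; no claim on BSD in rank ≥ 2.

The census instrument MS9 (`SCHNEIDER-CENSUS.md` §3.5, `PREREG-MS9.md`) reads the analytic
Iwasawa `λ`-invariant event `λ ≥ r + 1` of a power series `L = T^r · g(T) ∈ ℤ_p⟦T⟧` (`μ = 0`)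
off the FIRST LAYER of the cyclotomic tower, i.e. off the image of `L` in
`ℤ_p[T]/(ω₁)`, `ω₁ = (1+T)^p − 1`, which is what the level-`p²` modular symbols give (the
Mazur–Tate element `θ₁`).  The dictionary used there ("identity I1: `p ∣ m ⟺ λ ≥ r+1`") rests on
the following piece of exact algebra, proved here over `ℤ[X]` for every prime `p` and every `r`:

* `firstLayer_coeff_congr` — for `g : ℤ[X]` and `j < p`, the `j`-th coefficient of the remainder
  `(X^r * g) %ₘ ((X+1)^p − 1)` is congruent mod `p` to `g.coeff (j − r)` if `r ≤ j` and to `0`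
  otherwise.  In particular (`j = r < p`): the coefficient of `T^r` in the first-layer element is
  `≡ g(0) (mod p)`, so it is divisible by `p` iff `p ∣ g(0)` iff `λ(g) ≥ 1` (when `μ(g) = 0`),
  and (`j < r`) the lower coefficients are `≡ 0 (mod p)` — the census's structural check that the
  first-layer element of a rank-`r` curve is `p`-adically divisible below degree `r`.

The proof: reduce mod `p`; `(X+1)^p − 1 ↦ X^p` in `(ZMod p)[X]` (freshman's dream), and the
remainder of `X^r ḡ` modulo `X^p` has the same coefficients as `X^r ḡ` below degree `p`.
Nothing here is specific to elliptic curves; it is the algebra behind one census column.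
-/

open Polynomial

namespace Summit.BirchSwinnertonDyer.BirchSwinnertonDyer.Rank2Observatory

/-- The first-layer relation polynomial `ω₁ = (X+1)^p − 1 ∈ ℤ[X]`. -/
noncomputable def omegaOne (p : ℕ) : ℤ[X] := (X + 1) ^ p - 1

/-- `ω₁` is monic (for `p > 0`). -/
theorem omegaOne_monic (p : ℕ) (hp : 0 < p) : (omegaOne p).Monic := by
  unfold omegaOne
  have h1 : ((X : ℤ[X]) + 1) = X + C 1 := by simp
  rw [h1]
  apply Monic.sub_of_left ((monic_X_add_C 1).pow p)
  rw [degree_one, degree_pow, degree_X_add_C, nsmul_one]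
  exact_mod_cast hp

/-- Reduction of `ω₁` mod `p`: `((X+1)^p − 1).map (ℤ → ZMod p) = X^p`. -/
theorem omegaOne_map_zmod (p : ℕ) [hp : Fact p.Prime] :
    (omegaOne p).map (Int.castRingHom (ZMod p)) = X ^ p := by
  unfold omegaOne
  simp only [Polynomial.map_sub, Polynomial.map_pow, Polynomial.map_add, Polynomial.map_X,
    Polynomial.map_one]
  rw [add_pow_char (X : (ZMod p)[X]) 1 p, one_pow, add_sub_cancel_right]

/-- Coefficients below degree `p` survive reduction modulo `X^p`. -/
theorem coeff_modByMonic_X_pow_of_lt {R : Type*} [CommRing R] (f : R[X]) (p j : ℕ) (hj : j < p) :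
    (f %ₘ X ^ p).coeff j = f.coeff j := by
  have h := modByMonic_add_div f (X ^ p)
  -- f %ₘ X^p + X^p * (f /ₘ X^p) = f
  have hc := congrArg (fun q : R[X] => q.coeff j) h
  simp only [coeff_add, coeff_X_pow_mul', if_neg (not_le.mpr hj), add_zero] at hc
  exact hc

/-- FIRST-LAYER TRUNCATION LEMMA (instrument MS9, identity I1's algebra): for `g : ℤ[X]`, a prime
`p` and `j < p`, the `j`-th coefficient of `(X^r · g) mod ((X+1)^p − 1)` is congruent mod `p` to
`g.coeff (j − r)` when `r ≤ j`, and to `0` when `j < r`. -/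
theorem firstLayer_coeff_congr (p : ℕ) [hp : Fact p.Prime] (r : ℕ) (g : ℤ[X]) (j : ℕ) (hj : j < p) :
    (p : ℤ) ∣ ((X ^ r * g) %ₘ omegaOne p).coeff j - (if r ≤ j then g.coeff (j - r) else 0) := by
  set φ := Int.castRingHom (ZMod p) with hφ
  have hω : (omegaOne p).Monic := omegaOne_monic p hp.out.pos
  -- reduce the remainder mod p
  have key : ((X ^ r * g) %ₘ omegaOne p).map φ = (X ^ r * g.map φ) %ₘ X ^ p := by
    rw [Polynomial.map_modByMonic φ hω, omegaOne_map_zmod]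
    simp
  have kc := congrArg (fun q : (ZMod p)[X] => q.coeff j) key
  simp only [coeff_map] at kc
  rw [coeff_modByMonic_X_pow_of_lt _ p j hj, coeff_X_pow_mul'] at kc
  -- kc : φ (((X^r * g) %ₘ ω).coeff j) = if r ≤ j then (g.map φ).coeff (j - r) else 0
  rw [← ZMod.intCast_zmod_eq_zero_iff_dvd, Int.cast_sub, sub_eq_zero]
  have : ((((X ^ r * g) %ₘ omegaOne p).coeff j : ℤ) : ZMod p) = φ (((X ^ r * g) %ₘ omegaOne p).coeff j) := by
    simp [hφ]
  rw [this, kc]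
  split_ifs with h
  · simp [coeff_map, hφ]
  · simp

/-- Special case used by the census at `p = 3`, rank `2`: the `T²`-coefficient of the first-layer
element is `≡ g(0) (mod 3)` and the `T¹`- and `T⁰`-coefficients are `≡ 0 (mod 3)`. -/
theorem firstLayer_rank_two_p3 (g : ℤ[X]) :
    (3 : ℤ) ∣ ((X ^ 2 * g) %ₘ omegaOne 3).coeff 2 - g.coeff 0 ∧
    (3 : ℤ) ∣ ((X ^ 2 * g) %ₘ omegaOne 3).coeff 1 ∧
    (3 : ℤ) ∣ ((X ^ 2 * g) %ₘ omegaOne 3).coeff 0 := by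
  haveI : Fact (Nat.Prime 3) := ⟨by norm_num⟩
  refine ⟨?_, ?_, ?_⟩
  · simpa using firstLayer_coeff_congr 3 2 g 2 (by norm_num)
  · simpa using firstLayer_coeff_congr 3 2 g 1 (by norm_num)
  · simpa using firstLayer_coeff_congr 3 2 g 0 (by norm_num)



/-! ## The second-layer filtration facts behind identity I4

In `Λ₂ = ℤ₃[T]/(ω₂)`, `ω₂ = (1+T)^9 − 1`, the augmentation ideal is `I = (T)` and
`I^k = (T^k) + (ω₂)`.  Identity I4 of the census (Mazur–Tate extra vanishing at layer 27
detects `9 ∣` the leading term) rests on: `9·T ∈ (T², ω₂)` while `3·T ∉ (T², ω₂)`.  Both are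
statements about `ℤ[X]` (the second one a fortiori over `ℤ`, by the same linear-coefficient
argument that works over `ℤ₃`). -/

/-- `ω₂ = (X+1)^9 − 1`. -/
noncomputable def omegaTwo : ℤ[X] := (X + 1) ^ 9 - 1

/-- `9·X` lies in the ideal `(X², ω₂)` of `ℤ[X]`: explicitly `9X = ω₂ − X²·r`. -/
theorem nine_X_mem : ∃ q r : ℤ[X], (9 : ℤ[X]) * X = q * omegaTwo + X ^ 2 * r := by
  refine ⟨1, -(X ^ 7 + 9 * X ^ 6 + 36 * X ^ 5 + 84 * X ^ 4 + 126 * X ^ 3 + 126 * X ^ 2 + 84 * X + 36), ?_⟩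
  unfold omegaTwo
  ring

/-- The linear coefficient of `ω₂` is `9` and its constant coefficient is `0`. -/
theorem omegaTwo_coeff_one : omegaTwo.coeff 1 = 9 ∧ omegaTwo.coeff 0 = 0 := by
  unfold omegaTwo
  have h : ((X : ℤ[X]) + 1) ^ 9 - 1
      = X ^ 9 + 9 * X ^ 8 + 36 * X ^ 7 + 84 * X ^ 6 + 126 * X ^ 5 + 126 * X ^ 4 + 84 * X ^ 3
        + 36 * X ^ 2 + 9 * X := by ring
  rw [h]
  constructor <;> simp [coeff_X_pow, coeff_X]

/-- `3·X` does NOT lie in `(X², ω₂)`: comparing coefficients of `X¹` gives `3 = 9·q₀`. -/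
theorem three_X_not_mem : ¬ ∃ q r : ℤ[X], (3 : ℤ[X]) * X = q * omegaTwo + X ^ 2 * r := by
  rintro ⟨q, r, h⟩
  have hc := congrArg (fun f : ℤ[X] => f.coeff 1) h
  simp only [coeff_add] at hc
  have h1 : ((3 : ℤ[X]) * X).coeff 1 = 3 := by
    rw [show (3 : ℤ[X]) = C 3 by simp]; simp [coeff_X]
  have h2 : (X ^ 2 * r : ℤ[X]).coeff 1 = 0 := by
    rw [coeff_X_pow_mul']; simp
  have h3 : (q * omegaTwo).coeff 1 = 9 * q.coeff 0 := by
    rw [coeff_mul, Finset.Nat.antidiagonal_succ, Finset.sum_cons, Finset.Nat.antidiagonal_zero]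
    simp [omegaTwo_coeff_one.1, omegaTwo_coeff_one.2, mul_comm]
  rw [h1, h2, h3] at hc
  omega

end Summit.BirchSwinnertonDyer.BirchSwinnertonDyer.Rank2Observatory
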